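import Literature.Probability.LatticeModels.FKIsingTopologicalRectangleCrossingProofs
import HarnessLib

/-!
# Shrinking a boundary arc of a discrete topological rectangle increases `ℓ_Ω` boundedly
# (the arc-shrinking step of Chelkak–Duminil-Copin–Hongler 2016, §4.3)

Topic `Literature/Probability/LatticeModels` (family `crit-ising`); a PROVED glue step of the printed proof
of CDH16 Thm. 1.1 (`fkIsing_topologicalRectangle_crossingBounds`, `FKIsingTopologicalRectangleCrossing.lean`),
in its vocabulary (`DiscreteRect.IsRect E d₀ n`, arcs `DiscreteRect.arcVerts`, boundary tracing
`DiscreteRect.succ`, `effectiveResistance (fromEdgeSet ↑E) 1 (arcVerts 0) (arcVerts 2) = ℓ_Ω[(ab),(cd)]`).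
No named facts, no definitions.

D. Chelkak, H. Duminil-Copin, C. Hongler, EJP 21 (2016) no. 5 = arXiv:1312.7785, §4.3, proof of
Theorem 1.1 (i) (held text p. 14): "for each fixed `L₀ > 0` we may assume that either `ℓ_Ω[a,c] ≤ L₀` or
(4.6) `L₀ ≤ ℓ_Ω[(ab),(cd)] ≤ max{L, L₀ + c₀}` provided that an absolute constant `c₀ > 0` is chosen large
enough. Indeed, let `ℓ_Ω[(ab),(cd)] < L₀`. Then one can shrink the boundary arcs step by step (thus
increasing the extremal length), arriving at smaller arcs `(ab′)` and `(cd′)` such that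
`L₀ ≤ ℓ_Ω[(ab′),(cd′)] ≤ L₀ + c₀` (note that the increment of `ℓ_Ω` on each step is uniformly bounded).
Clearly, `φ^∅_Ω[(ab′) ↔ (cd′)] ≤ φ^∅_Ω[(ab) ↔ (cd)]`".

## Main results (all proved)

* abstract networks (unit conductances, Dirichlet's principle of `EffectiveResistance.lean`):
  `ofReal_sq_sub_le_length_sq_mul_networkEnergy` (`(v(a) - v(b))² ≤ |p|² 𝓔(v)` along a walk `p`),
  `networkEnergy_update_le` (resetting a potential at one vertex `x` costs at most `Σ_{y∼x} (t - v(y))²`),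
  `effectiveConductance_insert_le_mul` (`𝒞(A ∪ {x} ↔ C) ≤ (1 + #N(x) (m+1)²) 𝒞(A ↔ C)` when `x ∉ C` is
  joined to `A` by a walk of length `m`), `effectiveResistance_le_mul_insert_add`
  (`ℛ(A ↔ C) ≤ (1 + #N(x)(m+1)²) ℛ(A ∪ {x} ↔ C) + m²`, covering `x ∈ C`);
* the rectangle: `DiscreteRect.exists_walk_succ_length_le_three` (boundary tracing moves along `≤ 3`
  edges), `IsRect.shrink0` / `IsRect.shrink2` (removing the last dart of the arc `(ab)`, resp. `(cd)`, gives a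
  rectangle `(n₀-1, n₁+1, n₂, n₃)`, resp. `(n₀, n₁, n₂-1, n₃+1)`), the arc bookkeeping
  (`arcVerts_zero_eq_insert_shrink0`, `arcVerts_shrink0_two`, …, `arcVerts_eq_singleton_of_eq_one`), and the
  one-step bounds **`IsRect.resistance_shrink0_le`**, **`IsRect.resistance_shrink2_le`**:
  `ℓ_Ω[(ab′),(cd)] ≤ 65 ℓ_Ω[(ab),(cd)] + 9` and `ℓ_Ω[(ab),(cd′)] ≤ 65 ℓ_Ω[(ab),(cd)] + 9` (the printed
  "uniformly bounded increment" in the multiplicative-additive form that Dirichlet's principle gives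
  directly; this is all §4.3 needs: starting below `L₀` one stops at the first step with `ℓ ≥ L₀`, where
  `ℓ ≤ 65 L₀ + 9`), together with the monotonicity of the crossing event under shrinking
  (`openCrossing_mono`, `arcVerts_shrink0_zero_subset`, `arcVerts_shrink2_two_subset`).

Proof of the one-step bound: the removed vertex `x` is the base of the successor of the last-but-one dart,
hence joined to the shrunk arc by a walk of `≤ 3` edges of `Ω` and of degree `≤ 4`; for an admissible
potential `v` of the shrunk problem, `v` reset to `1` at `x` is admissible for the original one and its
energy exceeds `𝓔(v)` by at most `Σ_{y∼x}(1 - v(y))² ≤ 4 · 4² 𝓔(v)`.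

## References
* [ChelkakDuminilCopinHongler2016] D. Chelkak, H. Duminil-Copin, C. Hongler, EJP 21 (2016) no. 5, §4.3
  (proof of Thm. 1.1 (i), arc shrinking).
* [LyonsPeres2016] R. Lyons, Y. Peres, *Probability on Trees and Networks*, CUP 2016, §2.4 Exercise 2.13
  (Dirichlet's principle).
-/

noncomputable section

open scoped ENNReal NNReal
open SimpleGraph Finset

namespace Literature.Probability.LatticeModels

/-! ### Abstract network lemmas: shrinking a boundary set by one vertex -/

section ShrinkAbstract

variable {V : Type*} {G : SimpleGraph V}

/-- A single edge term is at most the energy. [folklore] -/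
theorem ofReal_sqIncr_le_networkEnergy (v : V → ℝ) {e : Sym2 V} (he : e ∈ G.edgeSet) :
    ENNReal.ofReal (sqIncr v e) ≤ networkEnergy G 1 v := by
  rw [DiscreteRect.networkEnergy_one_eq]
  calc ENNReal.ofReal (sqIncr v e) = G.edgeSet.indicator (fun e ↦ ENNReal.ofReal (sqIncr v e)) e :=
        (Set.indicator_of_mem he (fun e ↦ ENNReal.ofReal (sqIncr v e))).symm
    _ ≤ _ := ENNReal.le_tsum e

/-- **Cauchy–Schwarz along a walk**: `(v(a) - v(b))² ≤ |p| · Σ_{e ∈ p} dv(e)²`. [folklore] -/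
theorem sq_sub_le_length_mul_sum_sqIncr (v : V → ℝ) {a b : V} (p : G.Walk a b) :
    (v a - v b) ^ 2 ≤ p.length * (p.edges.map (sqIncr v)).sum := by
  induction p with
  | nil => simp
  | @cons x y z h p ih =>
    rw [Walk.length_cons, Walk.edges_cons, List.map_cons, List.sum_cons, sqIncr_mk, Nat.cast_succ]
    have hS : 0 ≤ (p.edges.map (sqIncr v)).sum := List.sum_nonneg (fun q hq ↦ by
      obtain ⟨e, -, rfl⟩ := List.mem_map.1 hq
      exact sqIncr_nonneg v e)
    have hL : (0 : ℝ) ≤ p.length := Nat.cast_nonneg _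
    rcases Nat.eq_zero_or_pos p.length with h0 | hpos
    · have hyz : y = z := Walk.eq_of_length_eq_zero h0
      subst hyz
      rw [h0, Nat.cast_zero, zero_add, one_mul]
      nlinarith [hS]
    · have hL' : (0 : ℝ) < p.length := by exact_mod_cast hpos
      nlinarith [ih, hS, sq_nonneg ((p.length : ℝ) * (v x - v y) - (v y - v z)),
        mul_pos hL' hL']

/-- Along a walk, `Σ_{e ∈ p} dv(e)² ≤ |p| · 𝓔(v)` (each edge term is at most the energy). [folklore] -/
theorem ofReal_sum_sqIncr_le_length_mul_networkEnergy (v : V → ℝ) {a b : V} (p : G.Walk a b) :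
    ENNReal.ofReal (p.edges.map (sqIncr v)).sum ≤ p.length * networkEnergy G 1 v := by
  induction p with
  | nil => simp
  | @cons x y z h p ih =>
    rw [Walk.length_cons, Walk.edges_cons, List.map_cons, List.sum_cons, Nat.cast_succ, add_mul, one_mul,
      add_comm ((p.length : ℝ≥0∞) * _)]
    have hS : 0 ≤ (p.edges.map (sqIncr v)).sum := List.sum_nonneg (fun q hq ↦ by
      obtain ⟨e, -, rfl⟩ := List.mem_map.1 hq
      exact sqIncr_nonneg v e)
    rw [ENNReal.ofReal_add (sqIncr_nonneg v _) hS]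
    exact add_le_add (ofReal_sqIncr_le_networkEnergy v ((mem_edgeSet G).2 h)) ih

/-- **The drop of a potential along a walk is controlled by the energy**:
`(v(a) - v(b))² ≤ |p|² · 𝓔(v)`. [folklore] -/
theorem ofReal_sq_sub_le_length_sq_mul_networkEnergy (v : V → ℝ) {a b : V} (p : G.Walk a b) :
    ENNReal.ofReal ((v a - v b) ^ 2) ≤ (p.length : ℝ≥0∞) ^ 2 * networkEnergy G 1 v := by
  calc ENNReal.ofReal ((v a - v b) ^ 2) ≤ ENNReal.ofReal (p.length * (p.edges.map (sqIncr v)).sum) :=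
        ENNReal.ofReal_le_ofReal (sq_sub_le_length_mul_sum_sqIncr v p)
    _ = p.length * ENNReal.ofReal (p.edges.map (sqIncr v)).sum := by
        rw [ENNReal.ofReal_mul (Nat.cast_nonneg _), ENNReal.ofReal_natCast]
    _ ≤ p.length * (p.length * networkEnergy G 1 v) :=
        mul_le_mul' le_rfl (ofReal_sum_sqIncr_le_length_mul_networkEnergy v p)
    _ = (p.length : ℝ≥0∞) ^ 2 * networkEnergy G 1 v := by rw [← mul_assoc, sq]

/-- **Energy of a potential changed at one vertex**: setting `v(x) := t` costs at most
`Σ_{y ∼ x} (t - v(y))²` (the old edge terms at `x` are dropped, all other terms are unchanged); `Nx` is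
any finite set containing the neighbours of `x`. [folklore] -/
theorem networkEnergy_update_le [DecidableEq V] [DecidableRel G.Adj] (v : V → ℝ) (x : V) (t : ℝ) (Nx : Finset V)
    (hNx : ∀ y, G.Adj x y → y ∈ Nx) :
    networkEnergy G 1 (Function.update v x t) ≤
      networkEnergy G 1 v + ∑ y ∈ Nx, if G.Adj x y then ENNReal.ofReal ((t - v y) ^ 2) else 0 := by
  classical
  set F : Sym2 V → ℝ≥0∞ := G.edgeSet.indicator (fun e ↦ ENNReal.ofReal (sqIncr (Function.update v x t) e))
    with hF
  set S : Finset (Sym2 V) := Nx.image (fun y ↦ s(x, y)) with hSdef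
  set H : Sym2 V → ℝ≥0∞ := (↑S : Set (Sym2 V)).indicator F with hH
  have hpt : ∀ e, F e ≤ G.edgeSet.indicator (fun e ↦ ENNReal.ofReal (sqIncr v e)) e + H e := by
    intro e
    induction e using Sym2.ind with
    | h a b =>
      by_cases hab : G.Adj a b
      · have he : s(a, b) ∈ G.edgeSet := (mem_edgeSet G).2 hab
        by_cases hx : x = a ∨ x = b
        · -- an edge at `x`: bounded by the `H` term
          have hS : s(a, b) ∈ S := by
            rcases hx with rfl | rfl
            · exact Finset.mem_image.2 ⟨b, hNx b hab, rfl⟩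
            · exact Finset.mem_image.2 ⟨a, hNx a hab.symm, Sym2.eq_swap⟩
          rw [hH, Set.indicator_of_mem (Finset.mem_coe.2 hS)]
          exact le_add_self
        · push Not at hx
          have hsame : sqIncr (Function.update v x t) s(a, b) = sqIncr v s(a, b) := by
            rw [sqIncr_mk, sqIncr_mk, Function.update_of_ne (Ne.symm hx.1), Function.update_of_ne (Ne.symm hx.2)]
          rw [hF, Set.indicator_of_mem he, Set.indicator_of_mem he, hsame]
          exact le_self_add
      · have he : s(a, b) ∉ G.edgeSet := (mem_edgeSet G).not.2 hab
        rw [hF, Set.indicator_of_notMem he]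
        exact bot_le
  have hHsum : ∑' e, H e = ∑ e ∈ S, F e := by
    rw [hH, tsum_eq_sum (s := S) (fun e he ↦ Set.indicator_of_notMem (fun h ↦ he (Finset.mem_coe.1 h)) _)]
    exact Finset.sum_congr rfl fun e he ↦ Set.indicator_of_mem (Finset.mem_coe.2 he) _
  have hSsum : ∑ e ∈ S, F e ≤ ∑ y ∈ Nx, if G.Adj x y then ENNReal.ofReal ((t - v y) ^ 2) else 0 := by
    rw [hSdef, Finset.sum_image (fun y _ y' _ h ↦ Sym2.congr_right.1 h)]
    refine Finset.sum_le_sum fun y _ ↦ ?_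
    by_cases hxy : G.Adj x y
    · have hne : x ≠ y := hxy.ne
      rw [if_pos hxy, hF, Set.indicator_of_mem ((mem_edgeSet G).2 hxy), sqIncr_mk, Function.update_self,
        Function.update_of_ne (Ne.symm hne)]
    · rw [if_neg hxy, hF, Set.indicator_of_notMem ((mem_edgeSet G).not.2 hxy)]
  rw [DiscreteRect.networkEnergy_one_eq, DiscreteRect.networkEnergy_one_eq]
  calc ∑' e, F e ≤ ∑' e, (G.edgeSet.indicator (fun e ↦ ENNReal.ofReal (sqIncr v e)) e + H e) :=
        ENNReal.tsum_le_tsum hpt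
    _ = ∑' e, G.edgeSet.indicator (fun e ↦ ENNReal.ofReal (sqIncr v e)) e + ∑' e, H e := ENNReal.tsum_add
    _ ≤ _ := by rw [hHsum]; exact add_le_add le_rfl hSsum

/-- **Adding one vertex to a boundary set multiplies the conductance by a bounded factor**: if `x ∉ C`
is joined to a vertex `x'` of `A` by a walk of length `m` and has at most `#Nx` neighbours, then
`𝒞(A ∪ {x} ↔ C) ≤ (1 + #Nx (m+1)²) 𝒞(A ↔ C)` (Dirichlet's principle with the potential reset to `1` at
`x`). [folklore] -/
theorem effectiveConductance_insert_le_mul [DecidableEq V] [DecidableRel G.Adj] {A C : Set V} {x x' : V} (hx' : x' ∈ A)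
    (hxC : x ∉ C) (q : G.Walk x' x) (Nx : Finset V) (hNx : ∀ y, G.Adj x y → y ∈ Nx) :
    effectiveConductance G 1 (insert x A) C ≤
      (1 + Nx.card * ((q.length : ℝ≥0∞) + 1) ^ 2) * effectiveConductance G 1 A C := by
  set K : ℝ≥0∞ := 1 + Nx.card * ((q.length : ℝ≥0∞) + 1) ^ 2 with hK
  have hK0 : K ≠ 0 := by rw [hK]; exact ne_of_gt (lt_of_lt_of_le zero_lt_one le_self_add)
  have hKtop : K ≠ ⊤ := by
    rw [hK]
    exact ENNReal.add_ne_top.2 ⟨ENNReal.one_ne_top, ENNReal.mul_ne_top (ENNReal.natCast_ne_top _)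
      (ENNReal.pow_ne_top (ENNReal.add_ne_top.2 ⟨ENNReal.natCast_ne_top _, ENNReal.one_ne_top⟩))⟩
  have key : ∀ v : V → ℝ, A.EqOn v 1 → C.EqOn v 0 →
      effectiveConductance G 1 (insert x A) C ≤ K * networkEnergy G 1 v := by
    intro v hvA hvC
    have hx'1 : v x' = 1 := hvA hx'
    have hA' : (insert x A).EqOn (Function.update v x 1) 1 := by
      intro z hz
      rcases eq_or_ne z x with rfl | hzx
      · simp
      · rw [Pi.one_apply, Function.update_of_ne hzx]
        exact hvA (Set.mem_of_mem_insert_of_ne hz hzx)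
    have hC' : C.EqOn (Function.update v x 1) 0 := by
      intro z hz
      have hzx : z ≠ x := fun h ↦ hxC (h ▸ hz)
      rw [Pi.zero_apply, Function.update_of_ne hzx]
      exact hvC hz
    have hterm : ∀ y ∈ Nx, (if G.Adj x y then ENNReal.ofReal ((1 - v y) ^ 2) else 0) ≤
        ((q.length : ℝ≥0∞) + 1) ^ 2 * networkEnergy G 1 v := by
      intro y _
      split_ifs with hxy
      · have h := ofReal_sq_sub_le_length_sq_mul_networkEnergy v (q.concat hxy)
        rw [Walk.length_concat, hx'1, Nat.cast_succ] at h
        exact h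
      · exact bot_le
    calc effectiveConductance G 1 (insert x A) C ≤ networkEnergy G 1 (Function.update v x 1) :=
          effectiveConductance_le_networkEnergy hA' hC'
      _ ≤ networkEnergy G 1 v + ∑ y ∈ Nx, (if G.Adj x y then ENNReal.ofReal ((1 - v y) ^ 2) else 0) :=
          networkEnergy_update_le v x 1 Nx hNx
      _ ≤ networkEnergy G 1 v + ∑ _y ∈ Nx, ((q.length : ℝ≥0∞) + 1) ^ 2 * networkEnergy G 1 v :=
          add_le_add le_rfl (Finset.sum_le_sum hterm)
      _ = K * networkEnergy G 1 v := by
          rw [Finset.sum_const, nsmul_eq_mul, hK, add_mul, one_mul, mul_assoc]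
  have hdiv : effectiveConductance G 1 (insert x A) C / K ≤ effectiveConductance G 1 A C :=
    le_effectiveConductance fun v hvA hvC ↦ by
      rw [ENNReal.div_le_iff hK0 hKtop, mul_comm]
      exact key v hvA hvC
  calc effectiveConductance G 1 (insert x A) C = K * (effectiveConductance G 1 (insert x A) C / K) :=
        (ENNReal.mul_div_cancel hK0 hKtop).symm
    _ ≤ K * effectiveConductance G 1 A C := mul_le_mul' le_rfl hdiv

/-- **Removing one vertex from a boundary set increases the resistance boundedly**:
`ℛ(A ↔ C) ≤ (1 + #Nx (m+1)²) ℛ(A ∪ {x} ↔ C) + m²` whenever `x` is joined to a vertex of `A` by a walk of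
length `m` (the additive term covers the case `x ∈ C`, where `ℛ(A ∪ {x} ↔ C) = 0` and
`ℛ(A ↔ C) ≤ m²`). This is the "uniformly bounded increment of `ℓ_Ω`" under shrinking of an arc used in
CDH16 §4.3. [cite: ChelkakDuminilCopinHongler2016, §4.3] -/
theorem effectiveResistance_le_mul_insert_add [DecidableEq V] {A C : Set V} {x x' : V} (hx' : x' ∈ A)
    (q : G.Walk x' x) (Nx : Finset V) (hNx : ∀ y, G.Adj x y → y ∈ Nx) :
    effectiveResistance G 1 A C ≤
      (1 + Nx.card * ((q.length : ℝ≥0∞) + 1) ^ 2) * effectiveResistance G 1 (insert x A) C +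
        (q.length : ℝ≥0∞) ^ 2 := by
  classical
  set K : ℝ≥0∞ := 1 + Nx.card * ((q.length : ℝ≥0∞) + 1) ^ 2 with hK
  have hK0 : K ≠ 0 := by rw [hK]; exact ne_of_gt (lt_of_lt_of_le zero_lt_one le_self_add)
  have hKtop : K ≠ ⊤ := by
    rw [hK]
    exact ENNReal.add_ne_top.2 ⟨ENNReal.one_ne_top, ENNReal.mul_ne_top (ENNReal.natCast_ne_top _)
      (ENNReal.pow_ne_top (ENNReal.add_ne_top.2 ⟨ENNReal.natCast_ne_top _, ENNReal.one_ne_top⟩))⟩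
  by_cases hxC : x ∈ C
  · -- `x ∈ C`: the resistance of `(A, C)` itself is at most `m²`
    refine le_add_left ?_
    rcases Nat.eq_zero_or_pos q.length with h0 | hpos
    · have hxx : x' = x := Walk.eq_of_length_eq_zero h0
      subst hxx
      rw [effectiveResistance_of_not_disjoint (Set.not_disjoint_iff.2 ⟨x', hx', hxC⟩)]
      exact bot_le
    · rw [effectiveResistance]
      have hlen0 : (q.length : ℝ≥0∞) ^ 2 ≠ 0 := pow_ne_zero _ (Nat.cast_ne_zero.2 hpos.ne')
      have hlentop : (q.length : ℝ≥0∞) ^ 2 ≠ ⊤ := ENNReal.pow_ne_top (ENNReal.natCast_ne_top _)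
      rw [ENNReal.inv_le_iff_inv_le]
      refine le_effectiveConductance fun v hvA hvC ↦ ?_
      have h := ofReal_sq_sub_le_length_sq_mul_networkEnergy v q
      rw [hvA hx', hvC hxC, Pi.one_apply, Pi.zero_apply, sub_zero, one_pow, ENNReal.ofReal_one] at h
      calc ((q.length : ℝ≥0∞) ^ 2)⁻¹ = ((q.length : ℝ≥0∞) ^ 2)⁻¹ * 1 := (mul_one _).symm
        _ ≤ ((q.length : ℝ≥0∞) ^ 2)⁻¹ * ((q.length : ℝ≥0∞) ^ 2 * networkEnergy G 1 v) := mul_le_mul' le_rfl h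
        _ = networkEnergy G 1 v := by rw [← mul_assoc, ENNReal.inv_mul_cancel hlen0 hlentop, one_mul]
  · refine le_add_right ?_
    have h := effectiveConductance_insert_le_mul hx' hxC q Nx hNx
    rw [effectiveResistance, effectiveResistance]
    calc (effectiveConductance G 1 A C)⁻¹ ≤ (effectiveConductance G 1 (insert x A) C / K)⁻¹ := by
          apply ENNReal.inv_le_inv.2
          rw [ENNReal.div_le_iff hK0 hKtop, mul_comm]
          exact h
      _ = K / effectiveConductance G 1 (insert x A) C := by
          rw [ENNReal.inv_div (Or.inl hKtop) (Or.inl hK0)]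
      _ = K * (effectiveConductance G 1 (insert x A) C)⁻¹ := div_eq_mul_inv _ _

end ShrinkAbstract

/-! ### Shrinking an arc of a discrete topological rectangle (CDH16 §4.3) -/

section ShrinkRect

namespace DiscreteRect

variable {E : Finset (Sym2 (Site 2))} {d₀ : Site 2 × Fin 4} {n : Fin 4 → ℕ}

/-- **Boundary tracing moves along at most three edges of the domain**: a walk of `⟨E⟩` of length
`≤ 3` from the base vertex of a dart to the base vertex of its successor (lengths `0, 1, 2, 3` in the four
cases of `succ`). [folklore] -/
theorem exists_walk_succ_length_le_three (d : Site 2 × Fin 4) :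
    ∃ p : (fromEdgeSet (↑E : Set (Sym2 (Site 2)))).Walk d.1 (succ E d).1, p.length ≤ 3 := by
  obtain ⟨x, k⟩ := d
  by_cases h1 : s(x, x + dir (k + 1)) ∈ E
  · by_cases h2 : s(x + dir (k + 1), x + dir (k + 1) + dir k) ∈ E
    · by_cases h3 : s(x + dir (k + 1) + dir k, x + dir (k + 1) + dir k + dir (k - 1)) ∈ E
      · have hs : succ E (x, k) = (x + dir (k + 1) + dir k + dir (k - 1), k - 2) := by
          simp [succ, h1, h2, h3]
        rw [hs]
        exact ⟨Walk.cons (fromEdgeSet_adj_of_mem (dir_ne_zero _) h1)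
          (Walk.cons (fromEdgeSet_adj_of_mem (dir_ne_zero _) h2)
            (Walk.cons (fromEdgeSet_adj_of_mem (dir_ne_zero _) h3) Walk.nil)), by simp⟩
      · have hs : succ E (x, k) = (x + dir (k + 1) + dir k, k - 1) := by
          simp [succ, h1, h2, h3]
        rw [hs]
        exact ⟨Walk.cons (fromEdgeSet_adj_of_mem (dir_ne_zero _) h1)
          (Walk.cons (fromEdgeSet_adj_of_mem (dir_ne_zero _) h2) Walk.nil), by simp⟩
    · have hs : succ E (x, k) = (x + dir (k + 1), k) := by
        simp [succ, h1, h2]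
      rw [hs]
      exact ⟨Walk.cons (fromEdgeSet_adj_of_mem (dir_ne_zero _) h1) Walk.nil, by simp⟩
  · have hs : succ E (x, k) = (x, k + 1) := by
      simp [succ, h1]
    rw [hs]
    exact ⟨Walk.nil, by simp⟩

/-- In a domain inside the lattice, the neighbours of `x` in `⟨E⟩` are among the four lattice
neighbours `x + e_k`. [folklore] -/
theorem mem_image_add_dir_of_adj (hE : ∀ e ∈ E, e ∈ (zdGraph 2).edgeSet) {x y : Site 2}
    (h : (fromEdgeSet (↑E : Set (Sym2 (Site 2)))).Adj x y) :
    y ∈ (Finset.univ : Finset (Fin 4)).image (fun k ↦ x + dir k) := by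
  rw [fromEdgeSet_adj] at h
  have hadj : (zdGraph 2).Adj x y := by
    have := hE _ (Finset.mem_coe.1 h.1)
    rwa [SimpleGraph.mem_edgeSet] at this
  rw [zdGraph_adj_iff] at hadj
  rw [Finset.mem_image]
  obtain ⟨i, hi | hi⟩ := hadj
  · fin_cases i
    · exact ⟨0, Finset.mem_univ _, by rw [hi]; simp [dir]⟩
    · exact ⟨1, Finset.mem_univ _, by rw [hi]; simp [dir]⟩
  · fin_cases i
    · exact ⟨2, Finset.mem_univ _, by rw [hi]; simp [dir]⟩
    · exact ⟨3, Finset.mem_univ _, by rw [hi]; simp [dir]⟩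

/-- Two arcs described by the same offset and the same number of darts coincide. [folklore] -/
theorem arcVerts_congr {n' : Fin 4 → ℕ} {j j' : Fin 4} (h1 : lo n' j' = lo n j) (h2 : n' j' = n j) :
    arcVerts E d₀ n' j' = arcVerts E d₀ n j := by
  ext x
  simp only [arcVerts, Set.mem_setOf_eq, h1, h2]

/-- An arc consisting of one dart is the singleton of its base vertex. [folklore] -/
theorem arcVerts_eq_singleton_of_eq_one {j : Fin 4} (h1 : n j = 1) :
    arcVerts E d₀ n j = {((succ E)^[lo n j] d₀).1} := by
  ext x
  simp only [arcVerts, Set.mem_setOf_eq, Set.mem_singleton_iff, h1]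
  constructor
  · rintro ⟨i, hi1, hi2, rfl⟩
    obtain rfl : i = lo n j := by omega
    rfl
  · rintro rfl
    exact ⟨lo n j, le_rfl, by omega, rfl⟩

/-! #### Shrinking the arc `(ab)` at its end `b`: `n ↦ (n₀ - 1, n₁ + 1, n₂, n₃)` -/

/-- The shrunk rectangle is a rectangle (same boundary cycle, the cut between the arcs `0` and `1` moved
back by one dart). [folklore] -/
theorem IsRect.shrink0 (h : IsRect E d₀ n) (h2 : 2 ≤ n 0) : IsRect E d₀ ![n 0 - 1, n 1 + 1, n 2, n 3] := by
  have hN : (![n 0 - 1, n 1 + 1, n 2, n 3] : Fin 4 → ℕ) 0 + (![n 0 - 1, n 1 + 1, n 2, n 3] : Fin 4 → ℕ) 1 +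
      (![n 0 - 1, n 1 + 1, n 2, n 3] : Fin 4 → ℕ) 2 + (![n 0 - 1, n 1 + 1, n 2, n 3] : Fin 4 → ℕ) 3 =
      n 0 + n 1 + n 2 + n 3 := by
    simp only [Matrix.cons_val_zero, Matrix.cons_val_one, Matrix.cons_val]
    omega
  refine ⟨h.subset_edgeSet, h.isExtDart, ?_, ?_, ?_, ?_⟩
  · intro j
    fin_cases j
    · simp only [Fin.zero_eta, Matrix.cons_val_zero]; omega
    · simp only [Fin.mk_one, Matrix.cons_val_one, Matrix.cons_val_zero]; omega
    · exact h.pos 2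
    · exact h.pos 3
  · rw [hN]; exact h.periodic
  · rw [hN]; exact h.injOn
  · rw [hN]; exact h.cover

/-- The arc `(cd)` is unchanged. [folklore] -/
theorem arcVerts_shrink0_two (h1 : 1 ≤ n 0) : arcVerts E d₀ ![n 0 - 1, n 1 + 1, n 2, n 3] 2 = arcVerts E d₀ n 2 :=
  arcVerts_congr (by simp only [lo, Matrix.cons_val_zero, Matrix.cons_val_one, Matrix.cons_val]; omega) rfl

/-- The arc `(da)` is unchanged. [folklore] -/
theorem arcVerts_shrink0_three (h1 : 1 ≤ n 0) : arcVerts E d₀ ![n 0 - 1, n 1 + 1, n 2, n 3] 3 = arcVerts E d₀ n 3 :=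
  arcVerts_congr (by simp only [lo, Matrix.cons_val_zero, Matrix.cons_val_one, Matrix.cons_val]; omega) rfl

/-- The old arc `(ab)` is the new one plus the base vertex of the removed dart. [folklore] -/
theorem arcVerts_zero_eq_insert_shrink0 (h1 : 1 ≤ n 0) :
    arcVerts E d₀ n 0 = insert ((succ E)^[n 0 - 1] d₀).1 (arcVerts E d₀ ![n 0 - 1, n 1 + 1, n 2, n 3] 0) := by
  ext x
  simp only [arcVerts, lo, Set.mem_setOf_eq, Set.mem_insert_iff, Matrix.cons_val_zero, zero_add, zero_le,
    true_and]
  constructor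
  · rintro ⟨i, hi, rfl⟩
    by_cases hi' : i = n 0 - 1
    · exact Or.inl (by rw [hi'])
    · exact Or.inr ⟨i, by omega, rfl⟩
  · rintro (rfl | ⟨i, hi, rfl⟩)
    · exact ⟨n 0 - 1, by omega, rfl⟩
    · exact ⟨i, by omega, rfl⟩

/-- The base vertex of the last-but-one dart of `(ab)` stays in the shrunk arc. [folklore] -/
theorem mem_arcVerts_shrink0_zero (h2 : 2 ≤ n 0) :
    ((succ E)^[n 0 - 2] d₀).1 ∈ arcVerts E d₀ ![n 0 - 1, n 1 + 1, n 2, n 3] 0 := by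
  simp only [arcVerts, lo, Set.mem_setOf_eq, Matrix.cons_val_zero, zero_add]
  exact ⟨n 0 - 2, Nat.zero_le _, by omega, rfl⟩

/-- **Shrinking the arc `(ab)` by one dart increases `ℓ_Ω[(ab),(cd)]` boundedly**:
`ℓ_Ω[(ab'),(cd)] ≤ 65 ℓ_Ω[(ab),(cd)] + 9` (CDH16 §4.3: "one can shrink the boundary arcs step by step
(thus increasing the extremal length) … note that the increment of `ℓ_Ω` on each step is uniformly
bounded"; here in the multiplicative-additive form given by Dirichlet's principle, with the removed vertex
joined to the shrunk arc by at most three edges of `Ω` and of degree at most four).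
[cite: ChelkakDuminilCopinHongler2016, §4.3] -/
theorem IsRect.resistance_shrink0_le (h : IsRect E d₀ n) (h2 : 2 ≤ n 0) :
    effectiveResistance (fromEdgeSet (↑E : Set (Sym2 (Site 2)))) 1 (arcVerts E d₀ ![n 0 - 1, n 1 + 1, n 2, n 3] 0)
        (arcVerts E d₀ ![n 0 - 1, n 1 + 1, n 2, n 3] 2) ≤
      65 * effectiveResistance (fromEdgeSet (↑E : Set (Sym2 (Site 2)))) 1 (arcVerts E d₀ n 0) (arcVerts E d₀ n 2)
        + 9 := by
  classical
  set x' : Site 2 := ((succ E)^[n 0 - 2] d₀).1 with hx'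
  have hx : ((succ E)^[n 0 - 1] d₀).1 = (succ E ((succ E)^[n 0 - 2] d₀)).1 := by
    rw [show n 0 - 1 = (n 0 - 2) + 1 by omega, Function.iterate_succ_apply']
  obtain ⟨q, hq⟩ := exists_walk_succ_length_le_three (E := E) ((succ E)^[n 0 - 2] d₀)
  set Nx : Finset (Site 2) := (Finset.univ : Finset (Fin 4)).image (fun k ↦ (succ E ((succ E)^[n 0 - 2] d₀)).1 + dir k)
    with hNx
  have hNx' : ∀ y, (fromEdgeSet (↑E : Set (Sym2 (Site 2)))).Adj (succ E ((succ E)^[n 0 - 2] d₀)).1 y → y ∈ Nx :=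
    fun y hy ↦ mem_image_add_dir_of_adj h.subset_edgeSet hy
  have hcard : (Nx.card : ℝ≥0∞) ≤ 4 := by
    have : Nx.card ≤ 4 := (Finset.card_image_le).trans (by simp)
    exact_mod_cast this
  have hlen : (q.length : ℝ≥0∞) ≤ 3 := by exact_mod_cast hq
  have hmain := effectiveResistance_le_mul_insert_add (C := arcVerts E d₀ ![n 0 - 1, n 1 + 1, n 2, n 3] 2)
    (mem_arcVerts_shrink0_zero (E := E) (d₀ := d₀) h2) q Nx hNx'
  have hins : insert (succ E ((succ E)^[n 0 - 2] d₀)).1 (arcVerts E d₀ ![n 0 - 1, n 1 + 1, n 2, n 3] 0) =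
      arcVerts E d₀ n 0 := by
    rw [← hx]
    exact (arcVerts_zero_eq_insert_shrink0 (by omega)).symm
  rw [hins, arcVerts_shrink0_two (by omega)] at hmain
  rw [arcVerts_shrink0_two (by omega)]
  refine hmain.trans (add_le_add (mul_le_mul' ?_ le_rfl) ?_)
  · calc (1 : ℝ≥0∞) + Nx.card * ((q.length : ℝ≥0∞) + 1) ^ 2 ≤ 1 + 4 * (3 + 1) ^ 2 := by gcongr
      _ = 65 := by norm_num
  · calc (q.length : ℝ≥0∞) ^ 2 ≤ 3 ^ 2 := by gcongr
      _ = 9 := by norm_num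

/-! #### Shrinking the arc `(cd)` at its end `d`: `n ↦ (n₀, n₁, n₂ - 1, n₃ + 1)` -/

/-- The shrunk rectangle is a rectangle. [folklore] -/
theorem IsRect.shrink2 (h : IsRect E d₀ n) (h2 : 2 ≤ n 2) : IsRect E d₀ ![n 0, n 1, n 2 - 1, n 3 + 1] := by
  have hN : (![n 0, n 1, n 2 - 1, n 3 + 1] : Fin 4 → ℕ) 0 + (![n 0, n 1, n 2 - 1, n 3 + 1] : Fin 4 → ℕ) 1 +
      (![n 0, n 1, n 2 - 1, n 3 + 1] : Fin 4 → ℕ) 2 + (![n 0, n 1, n 2 - 1, n 3 + 1] : Fin 4 → ℕ) 3 =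
      n 0 + n 1 + n 2 + n 3 := by
    simp only [Matrix.cons_val_zero, Matrix.cons_val_one, Matrix.cons_val]
    omega
  refine ⟨h.subset_edgeSet, h.isExtDart, ?_, ?_, ?_, ?_⟩
  · intro j
    fin_cases j
    · exact h.pos 0
    · exact h.pos 1
    · simp only [Fin.reduceFinMk, Matrix.cons_val]; omega
    · simp only [Fin.reduceFinMk, Matrix.cons_val]; omega
  · rw [hN]; exact h.periodic
  · rw [hN]; exact h.injOn
  · rw [hN]; exact h.cover

/-- The arc `(ab)` is unchanged. [folklore] -/
theorem arcVerts_shrink2_zero : arcVerts E d₀ ![n 0, n 1, n 2 - 1, n 3 + 1] 0 = arcVerts E d₀ n 0 :=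
  arcVerts_congr rfl rfl

/-- The arc `(bc)` is unchanged. [folklore] -/
theorem arcVerts_shrink2_one : arcVerts E d₀ ![n 0, n 1, n 2 - 1, n 3 + 1] 1 = arcVerts E d₀ n 1 :=
  arcVerts_congr rfl rfl

/-- The old arc `(cd)` is the new one plus the base vertex of the removed dart. [folklore] -/
theorem arcVerts_two_eq_insert_shrink2 (h1 : 1 ≤ n 2) :
    arcVerts E d₀ n 2 = insert ((succ E)^[lo n 2 + n 2 - 1] d₀).1 (arcVerts E d₀ ![n 0, n 1, n 2 - 1, n 3 + 1] 2) := by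
  have hlo : lo (![n 0, n 1, n 2 - 1, n 3 + 1] : Fin 4 → ℕ) 2 = lo n 2 := rfl
  have hn2 : (![n 0, n 1, n 2 - 1, n 3 + 1] : Fin 4 → ℕ) 2 = n 2 - 1 := rfl
  ext x
  simp only [arcVerts, Set.mem_setOf_eq, Set.mem_insert_iff, hlo, hn2]
  constructor
  · rintro ⟨i, hi1, hi2, rfl⟩
    by_cases hi' : i = lo n 2 + n 2 - 1
    · exact Or.inl (by rw [hi'])
    · exact Or.inr ⟨i, hi1, by omega, rfl⟩
  · rintro (rfl | ⟨i, hi1, hi2, rfl⟩)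
    · exact ⟨lo n 2 + n 2 - 1, by omega, by omega, rfl⟩
    · exact ⟨i, hi1, by omega, rfl⟩

/-- The base vertex of the last-but-one dart of `(cd)` stays in the shrunk arc. [folklore] -/
theorem mem_arcVerts_shrink2_two (h2 : 2 ≤ n 2) :
    ((succ E)^[lo n 2 + n 2 - 2] d₀).1 ∈ arcVerts E d₀ ![n 0, n 1, n 2 - 1, n 3 + 1] 2 := by
  have hlo : lo (![n 0, n 1, n 2 - 1, n 3 + 1] : Fin 4 → ℕ) 2 = lo n 2 := rfl
  have hn2 : (![n 0, n 1, n 2 - 1, n 3 + 1] : Fin 4 → ℕ) 2 = n 2 - 1 := rfl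
  simp only [arcVerts, Set.mem_setOf_eq, hlo, hn2]
  exact ⟨lo n 2 + n 2 - 2, by omega, by omega, rfl⟩

/-- **Shrinking the arc `(cd)` by one dart increases `ℓ_Ω[(ab),(cd)]` boundedly**:
`ℓ_Ω[(ab),(cd')] ≤ 65 ℓ_Ω[(ab),(cd)] + 9`. [cite: ChelkakDuminilCopinHongler2016, §4.3] -/
theorem IsRect.resistance_shrink2_le (h : IsRect E d₀ n) (h2 : 2 ≤ n 2) :
    effectiveResistance (fromEdgeSet (↑E : Set (Sym2 (Site 2)))) 1 (arcVerts E d₀ ![n 0, n 1, n 2 - 1, n 3 + 1] 0)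
        (arcVerts E d₀ ![n 0, n 1, n 2 - 1, n 3 + 1] 2) ≤
      65 * effectiveResistance (fromEdgeSet (↑E : Set (Sym2 (Site 2)))) 1 (arcVerts E d₀ n 0) (arcVerts E d₀ n 2)
        + 9 := by
  classical
  have hx : ((succ E)^[lo n 2 + n 2 - 1] d₀).1 = (succ E ((succ E)^[lo n 2 + n 2 - 2] d₀)).1 := by
    rw [show lo n 2 + n 2 - 1 = (lo n 2 + n 2 - 2) + 1 by omega, Function.iterate_succ_apply']
  obtain ⟨q, hq⟩ := exists_walk_succ_length_le_three (E := E) ((succ E)^[lo n 2 + n 2 - 2] d₀)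
  set Nx : Finset (Site 2) :=
    (Finset.univ : Finset (Fin 4)).image (fun k ↦ (succ E ((succ E)^[lo n 2 + n 2 - 2] d₀)).1 + dir k) with hNx
  have hNx' : ∀ y, (fromEdgeSet (↑E : Set (Sym2 (Site 2)))).Adj (succ E ((succ E)^[lo n 2 + n 2 - 2] d₀)).1 y →
      y ∈ Nx := fun y hy ↦ mem_image_add_dir_of_adj h.subset_edgeSet hy
  have hcard : (Nx.card : ℝ≥0∞) ≤ 4 := by
    have : Nx.card ≤ 4 := (Finset.card_image_le).trans (by simp)
    exact_mod_cast this
  have hlen : (q.length : ℝ≥0∞) ≤ 3 := by exact_mod_cast hq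
  have hmain := effectiveResistance_le_mul_insert_add (C := arcVerts E d₀ n 0)
    (mem_arcVerts_shrink2_two (E := E) (d₀ := d₀) h2) q Nx hNx'
  have hins : insert (succ E ((succ E)^[lo n 2 + n 2 - 2] d₀)).1 (arcVerts E d₀ ![n 0, n 1, n 2 - 1, n 3 + 1] 2) =
      arcVerts E d₀ n 2 := by
    rw [← hx]
    exact (arcVerts_two_eq_insert_shrink2 (by omega)).symm
  rw [hins] at hmain
  rw [arcVerts_shrink2_zero, effectiveResistance_comm, effectiveResistance_comm _ _ (arcVerts E d₀ n 0)]
  refine hmain.trans (add_le_add (mul_le_mul' ?_ le_rfl) ?_)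
  · calc (1 : ℝ≥0∞) + Nx.card * ((q.length : ℝ≥0∞) + 1) ^ 2 ≤ 1 + 4 * (3 + 1) ^ 2 := by gcongr
      _ = 65 := by norm_num
  · calc (q.length : ℝ≥0∞) ^ 2 ≤ 3 ^ 2 := by gcongr
      _ = 9 := by norm_num

/-- Shrinking an arc can only decrease the crossing event: `{(ab') ↔ (cd')} ⊆ {(ab) ↔ (cd)}` for
sub-arcs. [folklore] -/
theorem openCrossing_mono {V : Type*} {S A A' C C' : Set V} (hA : A' ⊆ A) (hC : C' ⊆ C) :
    Percolation.openCrossing S A' C' ⊆ Percolation.openCrossing S A C := by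
  rintro ω ⟨x, hx, y, hy, hxy⟩
  exact ⟨x, hA hx, y, hC hy, hxy⟩

/-- The shrunk arcs are sub-arcs: `(ab') ⊆ (ab)`. [folklore] -/
theorem arcVerts_shrink0_zero_subset (h1 : 1 ≤ n 0) :
    arcVerts E d₀ ![n 0 - 1, n 1 + 1, n 2, n 3] 0 ⊆ arcVerts E d₀ n 0 := by
  rw [arcVerts_zero_eq_insert_shrink0 (E := E) (d₀ := d₀) h1]
  exact Set.subset_insert _ _

/-- The shrunk arcs are sub-arcs: `(cd') ⊆ (cd)`. [folklore] -/
theorem arcVerts_shrink2_two_subset (h1 : 1 ≤ n 2) :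
    arcVerts E d₀ ![n 0, n 1, n 2 - 1, n 3 + 1] 2 ⊆ arcVerts E d₀ n 2 := by
  rw [arcVerts_two_eq_insert_shrink2 (E := E) (d₀ := d₀) h1]
  exact Set.subset_insert _ _

end DiscreteRect

end ShrinkRect

/-! #### Iterating the shrinking: the alternative (4.6) of CDH16 §4.3 -/

section ShrinkIterate

namespace DiscreteRect

variable {E : Finset (Sym2 (Site 2))} {d₀ : Site 2 × Fin 4}

/-- **The arc-shrinking alternative of CDH16 §4.3**: starting from a discrete topological rectangle with
`ℓ_Ω[(ab),(cd)] < L₀`, shrinking the arcs `(ab)` and `(cd)` dart by dart (each step multiplies `ℓ_Ω` by at most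
`65` and adds at most `9`, `IsRect.resistance_shrink0_le` / `IsRect.resistance_shrink2_le`) one reaches sub-arcs
`(ab') ⊆ (ab)`, `(cd') ⊆ (cd)` of a rectangle with the same boundary cycle such that EITHER
`L₀ ≤ ℓ_Ω[(ab'),(cd')] ≤ 65 L₀ + 9` (the printed alternative (4.6) `L₀ ≤ ℓ ≤ max{L, L₀ + c₀}`, before taking the
maximum with the unshrunk case) OR both arcs are single darts and still `ℓ_Ω[(ab'),(cd')] < L₀` (the printed
alternative "`ℓ_Ω[a,c] ≤ L₀`": the arcs are then the singletons of their base vertices,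
`arcVerts_eq_singleton_of_eq_one`). [cite: ChelkakDuminilCopinHongler2016, §4.3] -/
theorem IsRect.exists_shrunk_arcs {n : Fin 4 → ℕ} (h : IsRect E d₀ n) {L₀ : ℝ≥0∞}
    (hℓ : effectiveResistance (fromEdgeSet (↑E : Set (Sym2 (Site 2)))) 1 (arcVerts E d₀ n 0) (arcVerts E d₀ n 2) < L₀) :
    ∃ n' : Fin 4 → ℕ, IsRect E d₀ n' ∧ arcVerts E d₀ n' 0 ⊆ arcVerts E d₀ n 0 ∧ arcVerts E d₀ n' 2 ⊆ arcVerts E d₀ n 2 ∧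
      ((L₀ ≤ effectiveResistance (fromEdgeSet (↑E : Set (Sym2 (Site 2)))) 1 (arcVerts E d₀ n' 0) (arcVerts E d₀ n' 2) ∧
          effectiveResistance (fromEdgeSet (↑E : Set (Sym2 (Site 2)))) 1 (arcVerts E d₀ n' 0) (arcVerts E d₀ n' 2) ≤
            65 * L₀ + 9) ∨
        (effectiveResistance (fromEdgeSet (↑E : Set (Sym2 (Site 2)))) 1 (arcVerts E d₀ n' 0) (arcVerts E d₀ n' 2) < L₀ ∧
          n' 0 = 1 ∧ n' 2 = 1)) := by
  -- strong induction on the total number of darts of the two arcs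
  suffices H : ∀ (m : ℕ) (n : Fin 4 → ℕ), n 0 + n 2 = m → IsRect E d₀ n →
      effectiveResistance (fromEdgeSet (↑E : Set (Sym2 (Site 2)))) 1 (arcVerts E d₀ n 0) (arcVerts E d₀ n 2) < L₀ →
      ∃ n' : Fin 4 → ℕ, IsRect E d₀ n' ∧ arcVerts E d₀ n' 0 ⊆ arcVerts E d₀ n 0 ∧
        arcVerts E d₀ n' 2 ⊆ arcVerts E d₀ n 2 ∧
        ((L₀ ≤ effectiveResistance (fromEdgeSet (↑E : Set (Sym2 (Site 2)))) 1 (arcVerts E d₀ n' 0) (arcVerts E d₀ n' 2) ∧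
            effectiveResistance (fromEdgeSet (↑E : Set (Sym2 (Site 2)))) 1 (arcVerts E d₀ n' 0) (arcVerts E d₀ n' 2) ≤
              65 * L₀ + 9) ∨
          (effectiveResistance (fromEdgeSet (↑E : Set (Sym2 (Site 2)))) 1 (arcVerts E d₀ n' 0) (arcVerts E d₀ n' 2) < L₀ ∧
            n' 0 = 1 ∧ n' 2 = 1)) from H _ n rfl h hℓ
  intro m
  induction m using Nat.strong_induction_on with
  | _ m ih =>
    intro n hm hn hℓn
    by_cases h0 : 2 ≤ n 0
    · -- shrink the arc `(ab)`
      have hshr := hn.resistance_shrink0_le h0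
      have hrect := hn.shrink0 h0
      have hsub0 := arcVerts_shrink0_zero_subset (E := E) (d₀ := d₀) (n := n) (by omega)
      have hsub2 : arcVerts E d₀ ![n 0 - 1, n 1 + 1, n 2, n 3] 2 ⊆ arcVerts E d₀ n 2 :=
        (arcVerts_shrink0_two (E := E) (d₀ := d₀) (by omega)).le
      have hbound : effectiveResistance (fromEdgeSet (↑E : Set (Sym2 (Site 2)))) 1
          (arcVerts E d₀ ![n 0 - 1, n 1 + 1, n 2, n 3] 0) (arcVerts E d₀ ![n 0 - 1, n 1 + 1, n 2, n 3] 2) ≤ 65 * L₀ + 9 :=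
        hshr.trans (add_le_add (mul_le_mul' le_rfl hℓn.le) le_rfl)
      by_cases hL : L₀ ≤ effectiveResistance (fromEdgeSet (↑E : Set (Sym2 (Site 2)))) 1
          (arcVerts E d₀ ![n 0 - 1, n 1 + 1, n 2, n 3] 0) (arcVerts E d₀ ![n 0 - 1, n 1 + 1, n 2, n 3] 2)
      · exact ⟨_, hrect, hsub0, hsub2, Or.inl ⟨hL, hbound⟩⟩
      · have hm' : (![n 0 - 1, n 1 + 1, n 2, n 3] : Fin 4 → ℕ) 0 + (![n 0 - 1, n 1 + 1, n 2, n 3] : Fin 4 → ℕ) 2 < m := by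
          simp only [Matrix.cons_val_zero, Matrix.cons_val]
          omega
        obtain ⟨n', hn', h0', h2', halt⟩ := ih _ hm' _ rfl hrect (not_le.1 hL)
        exact ⟨n', hn', h0'.trans hsub0, h2'.trans hsub2, halt⟩
    · by_cases h2 : 2 ≤ n 2
      · -- shrink the arc `(cd)`
        have hshr := hn.resistance_shrink2_le h2
        have hrect := hn.shrink2 h2
        have hsub0 : arcVerts E d₀ ![n 0, n 1, n 2 - 1, n 3 + 1] 0 ⊆ arcVerts E d₀ n 0 :=
          (arcVerts_shrink2_zero (E := E) (d₀ := d₀) (n := n)).le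
        have hsub2 := arcVerts_shrink2_two_subset (E := E) (d₀ := d₀) (n := n) (by omega)
        have hbound : effectiveResistance (fromEdgeSet (↑E : Set (Sym2 (Site 2)))) 1
            (arcVerts E d₀ ![n 0, n 1, n 2 - 1, n 3 + 1] 0) (arcVerts E d₀ ![n 0, n 1, n 2 - 1, n 3 + 1] 2) ≤ 65 * L₀ + 9 :=
          hshr.trans (add_le_add (mul_le_mul' le_rfl hℓn.le) le_rfl)
        by_cases hL : L₀ ≤ effectiveResistance (fromEdgeSet (↑E : Set (Sym2 (Site 2)))) 1
            (arcVerts E d₀ ![n 0, n 1, n 2 - 1, n 3 + 1] 0) (arcVerts E d₀ ![n 0, n 1, n 2 - 1, n 3 + 1] 2)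
        · exact ⟨_, hrect, hsub0, hsub2, Or.inl ⟨hL, hbound⟩⟩
        · have hm' : (![n 0, n 1, n 2 - 1, n 3 + 1] : Fin 4 → ℕ) 0 + (![n 0, n 1, n 2 - 1, n 3 + 1] : Fin 4 → ℕ) 2 < m := by
            simp only [Matrix.cons_val_zero, Matrix.cons_val]
            omega
          obtain ⟨n', hn', h0', h2', halt⟩ := ih _ hm' _ rfl hrect (not_le.1 hL)
          exact ⟨n', hn', h0'.trans hsub0, h2'.trans hsub2, halt⟩
      · -- both arcs are single darts
        have h01 : n 0 = 1 := by have := hn.pos 0; omega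
        have h21 : n 2 = 1 := by have := hn.pos 2; omega
        exact ⟨n, hn, le_rfl, le_rfl, Or.inr ⟨hℓn, h01, h21⟩⟩

end DiscreteRect

end ShrinkIterate

end Literature.Probability.LatticeModels

end
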